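import Summits.ResolutionOfSingularities.ResolutionOfSingularities.Theorems.FrobeniusClosingSteerStrippedThreadDivisor
import Summits.ResolutionOfSingularities.ResolutionOfSingularities.Theorems.FrobeniusClosingSteerNoSingularCarrierRun
import HarnessLib

/-!
# Stripped threads, part 3a: one block of a stripped thread (visit, strippings, identity steps)

W4.1, crux `Steer` (stmt-ResolutionOfSingularities-16345), σ-line, §σ2.25 v2.1 piece F-A3 `StrippedThreadTwoN` (Θ1♭, res-L0-w41-plan-1
RULING 36; owner res-D-pv-003, consult res-D-pv-011). Theses-free, def-free; sequel of `…StrippedThreadLemmas` (p520316),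
`…StrippedThreadGerm` (p521454), `…StrippedThreadDivisor` (p522759).

* **`block_decomposition`** — ONE BLOCK of a stripped thread: the visit blows up the member `R v` along the permissible thread centre
  `P v` (exceptional parameter `xx v`), the stages `v < m < v'` up to the next visit `v'` are either IDENTITY steps for the thread germ
  `G` (centre not below the thread prime: the parameter `xx m` is a unit of `G`, pv-011's `not_mem_of_not_le`) or HITS of height one
  (then `xx m = xx v · unit` by the hit lemma `excParam_hit_eq_mul_unit`, p522759); accumulating the strict-transform steps
  `s m = xx m · s (m+1) + gg m` gives **`s v = U · (xx v)^(n+1) · s v' + B`** with `U` a unit of `G`, `B ∈ R v'`, and `n ≥ 1` as soon as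
  the block contains a hit (`n` = the number of hits). The germ is given by its `locChar` over every member of the block (it does not
  move: part 1 + p514807), the thread primes by their contractions (`W (m+1) ∩ R m = W m`, `W m ∩ R v = P v`).
(The additive renormalisation of the radicands needed downstream is res-D-pv-007's `RadicandRenorm.isolated_renorm`, p522643.)
OURS (the W4.1 engine). [cite: Cutkosky2014, §2.1] [cite: NovacoskiSpivakovsky2014, Def. 2.11] [cite: Matsumura1987, Thm. 20.3]
-/

noncomputable section

-- `Summit.<S>.<S>.…` duplicates the summit name by design (single-problem summit).
set_option linter.dupNamespace false

open Polynomial IsLocalRing Literature.AlgebraicGeometry.Resolution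

namespace Summit.ResolutionOfSingularities.ResolutionOfSingularities.Theorems.SwitchingDichotomy.StrippedThread

/-! ## One block of a stripped thread -/

section Block

variable {K : Type} [Field K]

/-- **ONE BLOCK OF A STRIPPED THREAD.** See the module docstring. Data: the tower `R` with its centres `P`, strict-transform steps
`s i = xx i · s (i+1) + gg i` (`xx i` an exceptional parameter along `P i`, `gg i ∈ R i`), regular members `R i = (R i)_{𝔪_O ∩ R i} ⊆ O`;
the visit `v` (its centre `P v` prime with regular quotient) and the next visit `v'`; the thread primes `W m` (`v < m ≤ v'`) with
`W (m+1) ∩ R m = W m` and `W m ∩ R v = P v`; the thread germ `G` read on every member of the block; the HITS `v < m < v'` (`P m ≤ W m`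
⇒ prime of height `≤ 1`, singular for `s m ^ p`); the MINIMALITY of `P v` among the singular primes of `s v ^ p`. Conclusion:
`s v = U · (xx v)^(n+1) · s v' + B` with `U` a unit of `G`, `B ∈ R v'`, and `n ≥ 1` if some stage of the block is a hit.
OURS (the W4.1 engine). [cite: Cutkosky2014, §2.1] [cite: NovacoskiSpivakovsky2014, Def. 2.11] -/
theorem block_decomposition (p : ℕ) [hp : Fact p.Prime] [CharP K p] {O : ValuationSubring K}
    (R : ℕ → Subring K) (P W : (i : ℕ) → Ideal (R i)) (s xx gg : ℕ → K)
    (hregR : ∀ i, IsRegularLocalRing (R i))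
    (hRO : ∀ i, R i ≤ O.toSubring) (hloc : ∀ i, locAtCentre (R i) O = R i) (hmono : Monotone R)
    (hbl : ∀ i, IsLocalBlowupAlong O (R i) (P i) (R (i + 1)))
    (hxx : ∀ i, (∃ hx : xx i ∈ R i, (⟨xx i, hx⟩ : R i) ∈ P i) ∧ xx i ≠ 0 ∧
      ∀ y : R i, y ∈ P i → O.valuation (y : K) ≤ O.valuation (xx i))
    (hgg : ∀ i, gg i ∈ R i) (hsx : ∀ i, s i = xx i * s (i + 1) + gg i) (hsp : ∀ i, s i ^ p ∈ R i)
    (v v' : ℕ) (hvv' : v < v')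
    [hPv : (P v).IsPrime] (hquot : IsRegularLocalRing (R v ⧸ P v))
    (hWprime : ∀ m, v < m → m ≤ v' → (W m).IsPrime)
    (hWW : ∀ m, v < m → m < v' → (W (m + 1)).comap (Subring.inclusion (hmono (Nat.le_succ m))) = W m)
    (hWv : ∀ m (hm : v < m), m ≤ v' → (W m).comap (Subring.inclusion (hmono hm.le)) = P v)
    {G : Subring K} (hG : ∀ m, v < m → m ≤ v' → ∀ z : K, z ∈ G ↔ ∃ a b : R m, b ∉ W m ∧ z = (a : K) / b)
    (hhit : ∀ m, v < m → m < v' → P m ≤ W m → ∃ _ : (P m).IsPrime, (P m).height ≤ 1 ∧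
      ¬ IsRegularLocalRing (AdjoinRoot ((X : (Localization.AtPrime (P m))[X]) ^ p -
        C (algebraMap (R m) (Localization.AtPrime (P m)) ⟨s m ^ p, hsp m⟩))))
    (hmin : ∀ (Q : Ideal (R v)) [Q.IsPrime], Q < P v →
      IsRegularLocalRing (AdjoinRoot ((X : (Localization.AtPrime Q)[X]) ^ p -
        C (algebraMap (R v) (Localization.AtPrime Q) ⟨s v ^ p, hsp v⟩)))) :
    ∃ (n : ℕ) (U B : K), U ∈ G ∧ U⁻¹ ∈ G ∧ U ≠ 0 ∧ B ∈ R v' ∧ s v = U * xx v ^ (n + 1) * s v' + B ∧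
      ((∃ m, v < m ∧ m < v' ∧ P m ≤ W m) → 1 ≤ n) := by
  haveI : ∀ i, IsLocalRing (R i) := fun i => by haveI := hregR i; infer_instance
  have hval : ∀ a : R v, a ∈ maximalIdeal (R v) ↔ O.valuation (a : K) < 1 :=
    NoSingularCarrier.mem_maximalIdeal_iff_of_locAtCentre_eq (hRO v) (hloc v)
  have hPle : P v ≤ maximalIdeal (R v) := IsLocalRing.le_maximalIdeal hPv.ne_top
  haveI := hquot
  have hxR : ∀ i, xx i ∈ R i := fun i => (hxx i).1.fst
  have hxP : ∀ i, (⟨xx i, hxR i⟩ : R i) ∈ P i := fun i => (hxx i).1.snd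
  have hx0 : ∀ i, xx i ≠ 0 := fun i => (hxx i).2.1
  have hxmax : ∀ i, ∀ y : R i, y ∈ P i → O.valuation (y : K) ≤ O.valuation (xx i) := fun i => (hxx i).2.2
  -- `G` as a ring with 1, and `xx v ∈ W (v+1)`
  have hG1 := hG (v + 1) (Nat.lt_succ_self v) hvv'
  haveI hWv1 : (W (v + 1)).IsPrime := hWprime (v + 1) (Nat.lt_succ_self v) hvv'
  have hξW : ∃ hξR1 : xx v ∈ R (v + 1), (⟨xx v, hξR1⟩ : R (v + 1)) ∈ W (v + 1) := by
    refine ⟨hmono (Nat.le_succ v) (hxR v), ?_⟩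
    have h := hWv (v + 1) (Nat.lt_succ_self v) hvv'
    have : (⟨xx v, hxR v⟩ : R v) ∈ (W (v + 1)).comap (Subring.inclusion (hmono (Nat.lt_succ_self v).le)) := by
      rw [h]; exact hxP v
    rw [Ideal.mem_comap] at this
    exact this
  -- ### induction along the block: `s v = A · s m + B`, `A = U · (xx v)^(n+1)`
  have key : ∀ m, v + 1 ≤ m → m ≤ v' → ∃ (n : ℕ) (U A B : K), U ∈ G ∧ U⁻¹ ∈ G ∧ U ≠ 0 ∧ A ∈ R m ∧ B ∈ R m ∧
      A = U * xx v ^ (n + 1) ∧ s v = A * s m + B ∧ ((∃ m', v < m' ∧ m' < m ∧ P m' ≤ W m') → 1 ≤ n) := by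
    intro m hm
    induction m, hm using Nat.le_induction with
    | base =>
      intro _
      refine ⟨0, 1, xx v, gg v, G.one_mem, by rw [inv_one]; exact G.one_mem, one_ne_zero,
        hmono (Nat.le_succ v) (hxR v), hmono (Nat.le_succ v) (hgg v), by ring, hsx v, ?_⟩
      rintro ⟨m', h1, h2, -⟩
      omega
    | succ m hvm ih =>
      intro hm'
      have hmv' : m < v' := Nat.lt_of_succ_le hm'
      have hvm' : v < m := Nat.lt_of_succ_le hvm
      obtain ⟨n, U, A, B, hU, hUinv, hU0, hA, hB, hAU, hsv, hcount⟩ := ih hmv'.le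
      haveI : (W m).IsPrime := hWprime m hvm' hmv'.le
      haveI : (W (m + 1)).IsPrime := hWprime (m + 1) (Nat.lt_succ_of_lt hvm') hm'
      have hGm := hG m hvm' hmv'.le
      have hRmG : R m ≤ G := GeoDict.le_of_locChar hGm
      have hle' : R m ≤ R (m + 1) := hmono (Nat.le_succ m)
      -- the new decomposition
      have hsv' : s v = (A * xx m) * s (m + 1) + (A * gg m + B) := by rw [hsv, hsx m]; ring
      have hA' : A * xx m ∈ R (m + 1) := hle' ((R m).mul_mem hA (hxR m))
      have hB' : A * gg m + B ∈ R (m + 1) := hle' ((R m).add_mem ((R m).mul_mem hA (hgg m)) hB)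
      by_cases hPW : P m ≤ W m
      · -- ### HIT: `xx m = xx v · u`
        obtain ⟨hPm, hh1, hsing⟩ := hhit m hvm' hmv' hPW
        haveI := hPm
        haveI := hregR m
        have hP1 : (P m).height = 1 := height_eq_one_of_isLocalBlowupAlong (hbl m) hh1
        have hrel : s v = U * xx v ^ (n + 1) * s m + B := by rw [hsv, hAU]
        obtain ⟨u, huG, huinv, hxu⟩ := excParam_hit_eq_mul_unit p hval hPle (hbl v) (hxx v) hG1 hξW hGm
          (hmono hvm'.le) (hWv m hvm' hmv'.le) (hRO m) (hloc m) hP1 hPW (hsp m) hsing (hxx m) (hsp v)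
          hU hUinv hU0 hB hrel hmin
        have hu0 : u ≠ 0 := by
          rintro rfl
          exact hx0 m (by rw [hxu, mul_zero])
        refine ⟨n + 1, U * u, A * xx m, A * gg m + B, G.mul_mem hU huG, ?_, mul_ne_zero hU0 hu0, hA', hB', ?_,
          hsv', fun _ => Nat.succ_le_succ (Nat.zero_le n)⟩
        · rw [mul_inv]; exact G.mul_mem hUinv huinv
        · rw [hAU, hxu]; ring
      · -- ### IDENTITY STEP: `xx m` is a unit of `G`
        have hdiv : ∀ y : R m, y ∈ P m → (y : K) / xx m ∈ R (m + 1) := by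
          intro y hy
          obtain ⟨r, hr, hyr⟩ := GeoDict.exists_mem_mul_of_isExcParamAlong (hbl m) ⟨hxR m, hxP m⟩ (hx0 m) (hxmax m) y hy
          rw [hyr, mul_div_cancel_right₀ _ (hx0 m)]
          exact hr
        have hxW : (⟨xx m, hxR m⟩ : R m) ∉ W m :=
          ThreadChain.not_mem_of_not_le hle' (hWW m hvm' hmv') (hxR m) (hx0 m) hdiv hPW
        have hxinvG : (xx m)⁻¹ ∈ G := by
          rw [← one_div]
          exact (hGm _).mpr ⟨1, ⟨xx m, hxR m⟩, hxW, by simp⟩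
        refine ⟨n, U * xx m, A * xx m, A * gg m + B, G.mul_mem hU (hRmG (hxR m)), ?_, mul_ne_zero hU0 (hx0 m), hA', hB',
          ?_, hsv', ?_⟩
        · rw [mul_inv]; exact G.mul_mem hUinv hxinvG
        · rw [hAU]; ring
        · rintro ⟨m', h1, h2, h3⟩
          rcases Nat.lt_succ_iff_lt_or_eq.mp h2 with h2 | rfl
          · exact hcount ⟨m', h1, h2, h3⟩
          · exact absurd h3 hPW
  obtain ⟨n, U, A, B, hU, hUinv, hU0, -, hB, hAU, hsv, hcount⟩ := key v' hvv' le_rfl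
  exact ⟨n, U, B, hU, hUinv, hU0, hB, by rw [hsv, hAU], hcount⟩

end Block

end Summit.ResolutionOfSingularities.ResolutionOfSingularities.Theorems.SwitchingDichotomy.StrippedThread

end
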